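import Summits.Parity.BatemanHorn.Theorems.SelbergDelangeRigidityLSDRealSegmentTailsTwoTopSide
import HarnessLib

/-!
# Route `SelbergDelangeRigidity`, crux `LSDRealSegment` (stmt-Parity-9770), line
# `product-anatomy-subcritical`: ingredients of clause (d) of `stub_tailsTwo` for the quadratic member

For ONE irreducible quadratic `g`, the balanced class (`p ≠ q > x^{1−δ}` both dividing `g(n)`) has the structure
`g(n) = m p q`, `m < w = 4H x^{2δ} < p, q`: the `w`-rough part of the value is `p q` (`Ω = 2`), and `y^{Ω(g(n))}` is `y²`
times the engine summand with the top weight of order `R₀ = 2`.  The rough factor of its harmonic sum,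
`Σ_{b ≤ N, w-rough, Ω(b) ≤ 2} ρ(b)/b`, is at most `(1 + C Σ_{w<p≤N} 1/p + C)²` (`tailsTwo_roughFactor_two_le`, registered
helper: every such `b` is `1`, `p`, `p²` or `pq`, a product of two members of `{1} ∪ {p} ∪ {p²}`), and the numerology of
`δ = δ(ε)` is `η^y (1 + C(log(2/η) + 2))² ≤ (2(1+2C)² + 48C²) √η`.  (For a linear PAIR the balanced class lies inside the top class.)
-/

open Filter Finset Polynomial
open scoped BigOperators Topology Classical

namespace Summit.Parity.BatemanHorn.Cruxes.LSDRealSegment.ProductAnatomySubcritical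

open Literature.NumberTheory.Sieve
open ArithmeticFunction (cardFactors)
noncomputable section

variable {k : ℕ}

/-! ### Structure of the balanced class of one value -/

/-- If two distinct primes `p, q > w` divide `v < w p q` then `roughPart w v = p q`. [folklore] -/
theorem roughPart_eq_of_two_primes_dvd {w : ℝ} {v p q : ℕ} (hp : p ∈ v.primeFactors) (hq : q ∈ v.primeFactors) (hpq : p ≠ q)
    (hwp : w < (p : ℝ)) (hwq : w < (q : ℝ)) (hv : (v : ℝ) < w * p * q) : roughPart w v = p * q := by
  have hp' := Nat.prime_of_mem_primeFactors hp
  have hq' := Nat.prime_of_mem_primeFactors hq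
  have hv0 : v ≠ 0 := (Nat.mem_primeFactors.mp hp).2.2
  have hdvd : p * q ∣ v := Nat.Coprime.mul_dvd_of_dvd_of_dvd ((Nat.coprime_primes hp' hq').mpr hpq)
    (Nat.dvd_of_mem_primeFactors hp) (Nat.dvd_of_mem_primeFactors hq)
  obtain ⟨m, hm⟩ := hdvd
  have hm0 : m ≠ 0 := fun h => hv0 (by rw [hm, h, mul_zero])
  have hp0 : (0 : ℝ) < p := by exact_mod_cast hp'.pos
  have hq0 : (0 : ℝ) < q := by exact_mod_cast hq'.pos
  have hmw : (m : ℝ) < w := by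
    have : (v : ℝ) = p * q * m := by rw [hm]; push_cast; ring
    rw [this] at hv
    have : (m : ℝ) * (p * q) < w * (p * q) := by nlinarith
    exact lt_of_mul_lt_mul_right this (by positivity)
  have h1 : roughPart w p = p := roughPart_eq_self_of_lt hp'.ne_zero fun r hr => by
    rw [hp'.primeFactors, Finset.mem_singleton] at hr; rw [hr]; exact hwp
  have h2 : roughPart w q = q := roughPart_eq_self_of_lt hq'.ne_zero fun r hr => by
    rw [hq'.primeFactors, Finset.mem_singleton] at hr; rw [hr]; exact hwq
  have h3 : roughPart w m = 1 := roughPart_eq_one_of_le hm0 fun r hr => by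
    have : (r : ℝ) ≤ m := by exact_mod_cast Nat.le_of_mem_primeFactors hr
    linarith
  rw [hm, roughPart_mul w (mul_ne_zero hp'.ne_zero hq'.ne_zero) hm0, roughPart_mul w hp'.ne_zero hq'.ne_zero, h1, h2, h3, mul_one]

/-- **The tilt on the balanced class** (`P ≤ w`, `Ω(roughPart w (fᵢ(n))) = 2`): `y^{Ω_f(n)}` is `y²` times the engine summand with
the top weight of order `2` at `i` and the plain peeled weights elsewhere. [folklore] -/
theorem pow_stat_eq_balSummand (f : Fin k → ℤ[X]) {y w : ℝ} {P : ℕ} (hPw : (P : ℝ) ≤ w) (n : ℕ) (i : Fin k)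
    (hΩ2 : cardFactors (roughPart w (val f i n)) = 2) :
    y ^ stat f n = y ^ 2 * ∏ j, (y ^ cardFactors (smoothPart (P : ℝ) (val f j n)) *
      (if j = i then y ^ cardFactors (smoothPart w (roughPart (P : ℝ) (val f j n))) *
        (if cardFactors (roughPart w (roughPart (P : ℝ) (val f j n))) ≤ 2 then (1 : ℝ) else 0)
       else y ^ cardFactors (roughPart (P : ℝ) (val f j n)))) := by
  have hL : y ^ stat f n = (y ^ cardFactors (smoothPart (P : ℝ) (val f i n)) * y ^ cardFactors (roughPart (P : ℝ) (val f i n))) *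
      ∏ j ∈ Finset.univ.erase i, (y ^ cardFactors (smoothPart (P : ℝ) (val f j n)) * y ^ cardFactors (roughPart (P : ℝ) (val f j n))) := by
    rw [pow_stat_eq_prod_smooth_rough f y P n, Finset.mul_prod_erase Finset.univ
      (fun j => y ^ cardFactors (smoothPart (P : ℝ) (val f j n)) * y ^ cardFactors (roughPart (P : ℝ) (val f j n))) (Finset.mem_univ i)]
  have hR : ∏ j, (y ^ cardFactors (smoothPart (P : ℝ) (val f j n)) *
      (if j = i then y ^ cardFactors (smoothPart w (roughPart (P : ℝ) (val f j n))) *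
        (if cardFactors (roughPart w (roughPart (P : ℝ) (val f j n))) ≤ 2 then (1 : ℝ) else 0)
       else y ^ cardFactors (roughPart (P : ℝ) (val f j n)))) =
      (y ^ cardFactors (smoothPart (P : ℝ) (val f i n)) * (y ^ cardFactors (smoothPart w (roughPart (P : ℝ) (val f i n))) *
        (if cardFactors (roughPart w (roughPart (P : ℝ) (val f i n))) ≤ 2 then (1 : ℝ) else 0))) *
      ∏ j ∈ Finset.univ.erase i, (y ^ cardFactors (smoothPart (P : ℝ) (val f j n)) * y ^ cardFactors (roughPart (P : ℝ) (val f j n))) := by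
    rw [← Finset.mul_prod_erase Finset.univ _ (Finset.mem_univ i), if_pos rfl]
    congr 1
    exact Finset.prod_congr rfl fun j hj => by rw [if_neg (Finset.ne_of_mem_erase hj)]
  rw [hL, hR]
  set r := roughPart (P : ℝ) (val f i n) with hr
  have hr0 : r ≠ 0 := roughPart_ne_zero _ _
  have hrw : roughPart w r = roughPart w (val f i n) := roughPart_roughPart_of_le hPw _
  have hΩ : cardFactors (roughPart w r) = 2 := by rw [hrw]; exact hΩ2
  have hkey : y ^ cardFactors r = y ^ 2 * (y ^ cardFactors (smoothPart w r) * (if cardFactors (roughPart w r) ≤ 2 then (1 : ℝ) else 0)) := by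
    rw [if_pos (by rw [hΩ]), mul_one, pow_cardFactors_eq_smooth_mul_rough y w hr0, hΩ]; ring
  rw [hkey]; ring

/-! ### The rough factor of order two -/

/-- **tailsTwo_roughFactor_two_le** (registered helper of `stub_tailsTwo`, line `product-anatomy-subcritical`): if `ρ(p) ≤ C`
and `ρ(p²) ≤ C` for all primes then `Σ_{b ≤ N, w-rough, Ω(b) ≤ 2} ρ(b)/b ≤ (1 + C Σ_{w<p≤N} 1/p + C)²` — every such `b` is a
product `u v` of two members of `U = {1} ∪ {p} ∪ {p²}` (`w < p ≤ N`) with `ρ(b)/b = (ρ(u)/u)(ρ(v)/v)`, and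
`Σ_U ρ(u)/u ≤ 1 + C Σ 1/p + C Σ 1/p²`. [folklore] -/
theorem tailsTwo_roughFactor_two_le : ∀ (g : ℤ[X]) (C : ℕ), (∀ p : ℕ, p.Prime → polyRootCountMod ![g] p ≤ C) →
    (∀ p : ℕ, p.Prime → polyRootCountMod ![g] (p ^ 2) ≤ C) → ∀ (w : ℝ) (N : ℕ),
    ∑ b ∈ (Finset.Icc 1 N).filter (fun b : ℕ => (∀ p ∈ b.primeFactors, w < (p : ℝ)) ∧ cardFactors b ≤ 2),
        (polyRootCountMod ![g] b : ℝ) / b ≤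
      (1 + C * (∑ p ∈ (Nat.primesLE N).filter (fun p : ℕ => w < (p : ℝ)), (1 : ℝ) / p) + C) ^ 2 := by
  intro g C hC hC2 w N
  set ρ : ℕ → ℝ := fun u => (polyRootCountMod ![g] u : ℝ) / u with hρ
  have hρ0 : ∀ u, 0 ≤ ρ u := fun u => by positivity
  set U := (Finset.Icc 1 N).filter (fun u : ℕ => (∀ p ∈ u.primeFactors, w < (p : ℝ)) ∧
    (cardFactors u ≤ 1 ∨ ∃ p : ℕ, p.Prime ∧ u = p ^ 2)) with hU
  set B := (Finset.Icc 1 N).filter (fun b : ℕ => (∀ p ∈ b.primeFactors, w < (p : ℝ)) ∧ cardFactors b ≤ 2) with hB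
  set h : ℕ × ℕ → ℝ := fun uv => ρ uv.1 * ρ uv.2 with hh
  have hh0 : ∀ uv, 0 ≤ h uv := fun uv => mul_nonneg (hρ0 _) (hρ0 _)
  -- (1) every `b ∈ B` is a product of two members of `U` with matching weight
  have hpair : ∀ b ∈ B, ∃ uv ∈ (U ×ˢ U).filter (fun uv : ℕ × ℕ => uv.1 * uv.2 = b), ρ b = h uv := by
    intro b hb
    rw [hB, Finset.mem_filter, Finset.mem_Icc] at hb
    obtain ⟨⟨hb1, hbN⟩, hrough, hΩ⟩ := hb
    have h1U : 1 ∈ U := by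
      rw [hU, Finset.mem_filter, Finset.mem_Icc]
      exact ⟨⟨le_rfl, hb1.trans hbN⟩, fun p hp => by simp [Nat.primeFactors_one] at hp, Or.inl (by simp)⟩
    have hρ1 : ρ 1 = 1 := by simp [hρ, polyRootCountMod_one]
    rcases Nat.lt_or_ge (cardFactors b) 2 with hlt | hge
    · refine ⟨(b, 1), Finset.mem_filter.mpr ⟨Finset.mem_product.mpr ⟨?_, h1U⟩, by simp⟩, ?_⟩
      · rw [hU, Finset.mem_filter, Finset.mem_Icc]
        exact ⟨⟨hb1, hbN⟩, hrough, Or.inl (show cardFactors b ≤ 1 by omega)⟩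
      · show ρ b = ρ b * ρ 1
        rw [hρ1, mul_one]
    · have hΩ2 : cardFactors b = 2 := le_antisymm hΩ hge
      have hb2 : 2 ≤ b := by
        by_contra h; push Not at h
        interval_cases b; simp at hΩ2
      set p := b.minFac with hp
      have hpp : p.Prime := Nat.minFac_prime (by omega)
      obtain ⟨q, hq⟩ : p ∣ b := hp ▸ Nat.minFac_dvd b
      have hq0 : q ≠ 0 := fun h0 => by rw [h0, mul_zero] at hq; omega
      have hΩq : cardFactors q = 1 := by
        have := hΩ2
        rw [hq, ArithmeticFunction.cardFactors_mul hpp.ne_zero hq0, ArithmeticFunction.cardFactors_apply_prime hpp] at this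
        omega
      have hqp : q.Prime := ArithmeticFunction.cardFactors_eq_one_iff_prime.mp hΩq
      have hwp : w < (p : ℝ) := hrough p (Nat.mem_primeFactors.mpr ⟨hpp, Nat.minFac_dvd b, by omega⟩)
      have hwq : w < (q : ℝ) := hrough q (Nat.mem_primeFactors.mpr ⟨hqp, ⟨p, by rw [hq]; ring⟩, by omega⟩)
      by_cases hpq : p = q
      · -- `b = p²`
        refine ⟨(b, 1), Finset.mem_filter.mpr ⟨Finset.mem_product.mpr ⟨?_, h1U⟩, by simp⟩, ?_⟩
        · rw [hU, Finset.mem_filter, Finset.mem_Icc]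
          exact ⟨⟨hb1, hbN⟩, hrough, Or.inr ⟨p, hpp, by rw [hq, ← hpq]; ring⟩⟩
        · show ρ b = ρ b * ρ 1
          rw [hρ1, mul_one]
      · refine ⟨(p, q), Finset.mem_filter.mpr ⟨Finset.mem_product.mpr ⟨?_, ?_⟩, by simp [hq]⟩, ?_⟩
        · rw [hU, Finset.mem_filter, Finset.mem_Icc]
          refine ⟨⟨hpp.one_lt.le, (hp ▸ Nat.minFac_le (by omega)).trans hbN⟩, fun r hr => ?_, Or.inl ?_⟩
          · rw [hpp.primeFactors, Finset.mem_singleton] at hr; rw [hr]; exact hwp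
          · rw [ArithmeticFunction.cardFactors_apply_prime hpp]
        · rw [hU, Finset.mem_filter, Finset.mem_Icc]
          refine ⟨⟨hqp.one_lt.le, le_trans (Nat.le_of_dvd (by omega) ⟨p, by rw [hq]; ring⟩) hbN⟩, fun r hr => ?_, Or.inl ?_⟩
          · rw [hqp.primeFactors, Finset.mem_singleton] at hr; rw [hr]; exact hwq
          · rw [hΩq]
        · simp only [hh, hρ]
          rw [hq, polyRootCountMod_mul_of_coprime_system _ ((Nat.coprime_primes hpp hqp).mpr hpq), Nat.cast_mul, Nat.cast_mul]
          have : (p : ℝ) ≠ 0 := by exact_mod_cast hpp.ne_zero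
          have : (q : ℝ) ≠ 0 := by exact_mod_cast hqp.ne_zero
          field_simp
  -- (2) sum over `B` against the pairs
  have hstep : ∑ b ∈ B, ρ b ≤ ∑ uv ∈ U ×ˢ U, h uv := by
    calc ∑ b ∈ B, ρ b ≤ ∑ b ∈ B, ∑ uv ∈ (U ×ˢ U).filter (fun uv : ℕ × ℕ => uv.1 * uv.2 = b), h uv := by
          refine Finset.sum_le_sum fun b hb => ?_
          obtain ⟨uv, huv, heq⟩ := hpair b hb
          rw [heq]
          exact Finset.single_le_sum (fun uv' _ => hh0 uv') huv
      _ ≤ ∑ uv ∈ U ×ˢ U, h uv := Finset.sum_fiberwise_le_sum_of_sum_fiber_nonneg fun b _ => Finset.sum_nonneg fun uv _ => hh0 uv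
  -- (3) the sum over `U`
  have hUsum : ∑ u ∈ U, ρ u ≤ 1 + C * (∑ p ∈ (Nat.primesLE N).filter (fun p : ℕ => w < (p : ℝ)), (1 : ℝ) / p) + C := by
    set A := (Finset.Icc 1 N).filter (fun b : ℕ => (∀ p ∈ b.primeFactors, w < (p : ℝ)) ∧ cardFactors b ≤ 1) with hA
    set Sq := (Nat.primesLE N).image (fun p : ℕ => p ^ 2) with hSq
    have hsub : U ⊆ A ∪ Sq := by
      intro u hu
      rw [hU, Finset.mem_filter] at hu
      rcases hu.2.2 with h1 | ⟨p, hp, rfl⟩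
      · exact Finset.mem_union_left _ (Finset.mem_filter.mpr ⟨hu.1, hu.2.1, h1⟩)
      · refine Finset.mem_union_right _ (Finset.mem_image.mpr ⟨p, Nat.mem_primesLE.mpr ⟨?_, hp⟩, rfl⟩)
        have := (Finset.mem_Icc.mp hu.1).2; nlinarith [hp.one_lt]
    have hA' := roughFactor_one_le g hC w N
    have hSq' : ∑ u ∈ Sq, ρ u ≤ C := by
      rw [hSq, Finset.sum_image fun p _ q _ hpq => Nat.pow_left_injective two_ne_zero hpq]
      calc ∑ p ∈ Nat.primesLE N, ρ (p ^ 2) ≤ ∑ p ∈ Nat.primesLE N, (C : ℝ) * (1 / ((p : ℝ) * (p - 1))) := by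
            refine Finset.sum_le_sum fun p hp => ?_
            have hp' := Nat.prime_of_mem_primesLE hp
            have hp2 : (2 : ℝ) ≤ p := by exact_mod_cast hp'.two_le
            simp only [hρ]
            rw [div_le_iff₀ (by exact_mod_cast pow_pos hp'.pos 2)]
            calc (polyRootCountMod ![g] (p ^ 2) : ℝ) ≤ C := by exact_mod_cast hC2 p hp'
              _ ≤ C * (1 / ((p : ℝ) * (p - 1))) * ((p ^ 2 : ℕ) : ℝ) := by
                  push_cast
                  rw [mul_assoc]
                  refine le_mul_of_one_le_right (Nat.cast_nonneg _) ?_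
                  rw [one_div_mul_eq_div, le_div_iff₀ (by nlinarith)]; nlinarith
        _ = C * ∑ p ∈ Nat.primesLE N, 1 / ((p : ℝ) * (p - 1)) := by rw [Finset.mul_sum]
        _ ≤ C * 1 := mul_le_mul_of_nonneg_left (Literature.NumberTheory.LFunctions.HallTenenbaum.sum_primesLE_inv_mul_pred_le_one N)
            (Nat.cast_nonneg _)
        _ = C := mul_one _
    calc ∑ u ∈ U, ρ u ≤ ∑ u ∈ A ∪ Sq, ρ u := Finset.sum_le_sum_of_subset_of_nonneg hsub fun u _ _ => hρ0 u
      _ = ∑ u ∈ A, ρ u + ∑ u ∈ Sq \ A, ρ u := by rw [← Finset.sum_union Finset.disjoint_sdiff, Finset.union_sdiff_self_eq_union]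
      _ ≤ ∑ u ∈ A, ρ u + ∑ u ∈ Sq, ρ u := add_le_add le_rfl (Finset.sum_le_sum_of_subset_of_nonneg Finset.sdiff_subset fun u _ _ => hρ0 u)
      _ ≤ _ := add_le_add hA' hSq'
  have hU0 : 0 ≤ ∑ u ∈ U, ρ u := Finset.sum_nonneg fun u _ => hρ0 u
  calc ∑ b ∈ B, ρ b ≤ ∑ uv ∈ U ×ˢ U, h uv := hstep
    _ = (∑ u ∈ U, ρ u) * ∑ v ∈ U, ρ v := by rw [Finset.sum_product, Finset.sum_mul_sum]
    _ ≤ _ := by rw [sq]; exact mul_le_mul hUsum hUsum hU0 (by positivity)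

/-- The numerology of `δ = δ(ε)` in clause (d): `η^y (1 + C(log(2/η) + 1) + C)² ≤ (2(1+2C)² + 48C²) √η`. [folklore] -/
theorem eta_bound_two {η y C : ℝ} (hη : 0 < η) (hη1 : η ≤ 1) (hy : 1 ≤ y) (hC : 0 ≤ C) :
    η ^ y * (1 + C * (Real.log (2 / η) + 1) + C) ^ 2 ≤ (2 * (1 + 2 * C) ^ 2 + 48 * C ^ 2) * η ^ (1 / 2 : ℝ) := by
  have h1 : η ^ y ≤ η := by
    have := Real.rpow_le_rpow_of_exponent_ge hη hη1 hy; rwa [Real.rpow_one] at this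
  have hs : η ^ (1 / 2 : ℝ) * η ^ (1 / 2 : ℝ) = η := by rw [← Real.rpow_add hη]; norm_num
  have hs0 : 0 < η ^ (1 / 2 : ℝ) := Real.rpow_pos_of_pos hη _
  have hs1 : η ^ (1 / 2 : ℝ) ≤ 1 := Real.rpow_le_one hη.le hη1 (by norm_num)
  have hηs : η ≤ η ^ (1 / 2 : ℝ) := by nlinarith
  -- `log(2/η) ≤ 4 (2/η)^{1/4}` and `((2/η)^{1/4})² = (2/η)^{1/2}`, `η (2/η)^{1/2} = √2 √η ≤ (3/2) √η`
  set t : ℝ := (2 / η) ^ (1 / 4 : ℝ) with ht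
  have ht0 : 0 ≤ t := Real.rpow_nonneg (by positivity) _
  have hlog : Real.log (2 / η) ≤ 4 * t := by
    have := Real.log_le_rpow_div (show (0 : ℝ) ≤ 2 / η by positivity) (show (0 : ℝ) < 1 / 4 by norm_num)
    rw [ht]; linarith [show (2 / η) ^ (1 / 4 : ℝ) / (1 / 4) = 4 * (2 / η) ^ (1 / 4 : ℝ) by ring]
  have ht2 : η * t ^ 2 ≤ 3 / 2 * η ^ (1 / 2 : ℝ) := by
    have e1 : t ^ 2 = (2 / η) ^ (1 / 2 : ℝ) := by
      rw [ht, ← Real.rpow_natCast, ← Real.rpow_mul (by positivity)]; norm_num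
    have e2 : η * (2 / η) ^ (1 / 2 : ℝ) = 2 ^ (1 / 2 : ℝ) * η ^ (1 / 2 : ℝ) := by
      rw [Real.div_rpow zero_le_two hη.le]; field_simp; nlinarith [hs]
    have h22 : (2 : ℝ) ^ (1 / 2 : ℝ) ≤ 3 / 2 := by
      have h4 : ((3 / 2 : ℝ) ^ 2) ^ (1 / 2 : ℝ) = 3 / 2 := by
        rw [show (1 / 2 : ℝ) = ((2 : ℕ) : ℝ)⁻¹ by norm_num]; exact Real.pow_rpow_inv_natCast (by norm_num) two_ne_zero
      rw [← h4]; exact Real.rpow_le_rpow zero_le_two (by norm_num) (by norm_num)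
    rw [e1, e2]; nlinarith
  have hlog0 : 0 ≤ Real.log (2 / η) := Real.log_nonneg (by rw [le_div_iff₀ hη]; linarith)
  have hsq : (1 + C * (Real.log (2 / η) + 1) + C) ^ 2 ≤ 2 * (1 + 2 * C) ^ 2 + 2 * (4 * C * t) ^ 2 := by
    have e : 1 + C * (Real.log (2 / η) + 1) + C = (1 + 2 * C) + C * Real.log (2 / η) := by ring
    rw [e]
    have hle : C * Real.log (2 / η) ≤ 4 * C * t := by nlinarith
    nlinarith [sq_nonneg ((1 + 2 * C) - C * Real.log (2 / η)), mul_nonneg hC hlog0]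
  calc η ^ y * (1 + C * (Real.log (2 / η) + 1) + C) ^ 2 ≤ η * (2 * (1 + 2 * C) ^ 2 + 2 * (4 * C * t) ^ 2) :=
        mul_le_mul h1 hsq (by positivity) hη.le
    _ = 2 * (1 + 2 * C) ^ 2 * η + 32 * C ^ 2 * (η * t ^ 2) := by ring
    _ ≤ 2 * (1 + 2 * C) ^ 2 * η ^ (1 / 2 : ℝ) + 32 * C ^ 2 * (3 / 2 * η ^ (1 / 2 : ℝ)) := by gcongr
    _ = (2 * (1 + 2 * C) ^ 2 + 48 * C ^ 2) * η ^ (1 / 2 : ℝ) := by ring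

end

end Summit.Parity.BatemanHorn.Cruxes.LSDRealSegment.ProductAnatomySubcritical
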